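import Mathlib
import Summits.CriticalPhenomena.PercolationContinuityZ3.Theorems.PercNearOneGluingNoHeavyLowerTailTNKernels
import Summits.CriticalPhenomena.PercolationContinuityZ3.Theorems.PercNearOneGluingNoHeavyLowerTailBandTwoTN
import Summits.CriticalPhenomena.PercolationContinuityZ3.Theorems.PercNearOneGluingNoHeavyLowerTailStairKernels
import Summits.CriticalPhenomena.PercolationContinuityZ3.Theorems.PercNearOneGluingNoHeavyLowerTailHurwitzPairTN
import HarnessLib

/-!
# THEOREM 3₀: three sub-neutral integer copies at `λ = 0`

Support file for the Sahi / Conjecture-P programme of route `PercNearOneGluingNoHeavy`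
(`--supports stmt-CriticalPhenomena-4575`, prover prim-l12-p5 gen 46; proof note
`prim-l12-p5/PROOF-HURWITZ-TRANSFER-g46.md` §1 and §3, blueprint `prim-l12-p5/LEAN-BLUEPRINT-3_0-g46.md`).
No definitions, no named facts, no sorries.

For three integer copies the `t`-coefficient matrix of `{t^l R(t,l)}_l` (gen 45's λ-free band matrix
`𝒪₀`) is column-banded with FOUR bands `d_0(l), …, d_3(l)` at positions `(l+i, l)`:
`d_0 = m(m-1)(m-2) + e₁(g) l m(m-1) + e₂(g) l(l-1) m + e₃(g) l(l-1)(l-2)`,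
`d_1 = Σ_i b_i [m(m-1) + (g_j+g_k) l m + g_j g_k l(l-1)]`, `d_2 = Σ_{i<j} b_i b_j (m + g_k l)`, `d_3 = b₁b₂b₃`.

**THEOREM 3₀ (`integerTriple_tn`).**  For `b_j > 0`, `0 < g_j ≤ 1`, `m > 2` this matrix is totally
nonnegative.  Proof (memo §1): the COPY-PEELING IDENTITY writes `p·W₃ = [B₃ | h₃ D]·R(W₂)` with
`R(W₂)` the operator Hurwitz matrix of the other two copies (`HurwitzPair.hurwitzPair_tn`, THEOREM R₂) and
a staircase left factor (`StairTN.stairs_minor_nonneg`), combined by `StairTN.mulBand_minor_nonneg`;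
`𝒪₀` is a positive diagonal rescaling of `p·W₃` (`TNKernel.det_kernel_scale`), and the boundary case
`g₁ = 1` (where THEOREM R₂'s strictness hypothesis fails) follows by continuity of the minors in `g₁`.
-/

namespace Summit.CriticalPhenomena.PercolationContinuityZ3.Theorems

namespace IntegerTripleTN

open Finset Matrix

/-- Sums against the doubled left factor: `Σ_{t ≤ 2n} ([t=2n]α_n + [t+1=2n]β_n + [t+2=2n]γ_n) f(t)
= α_n f(2n) + β_n f(2n-1) + γ_n f(2n-2)` (with `β_0 = γ_0 = 0`). -/
theorem sum_doubled (α β γ : ℕ → ℝ) (f : ℕ → ℝ) (hβ : β 0 = 0) (hγ : γ 0 = 0) (n : ℕ) :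
    ∑ t ∈ range (2 * n + 1),
        (if t = 2 * n then α n else if t + 1 = 2 * n then β n else if t + 2 = 2 * n then γ n else 0) * f t
      = α n * f (2 * n) + β n * f (2 * n - 1) + γ n * f (2 * n - 2) := by
  rcases Nat.eq_zero_or_pos n with rfl | hn
  · simp [hβ, hγ]
  · obtain ⟨k, rfl⟩ : ∃ k, n = k + 1 := ⟨n - 1, by omega⟩
    have h2 : 2 * (k + 1) + 1 = (2 * k) + 1 + 1 + 1 := by ring
    rw [h2, sum_range_succ, sum_range_succ, sum_range_succ]
    have hrest : ∑ t ∈ range (2 * k),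
        (if t = 2 * (k + 1) then α (k + 1) else if t + 1 = 2 * (k + 1) then β (k + 1)
          else if t + 2 = 2 * (k + 1) then γ (k + 1) else 0) * f t = 0 := by
      refine Finset.sum_eq_zero fun t ht => ?_
      rw [mem_range] at ht
      rw [if_neg (by omega), if_neg (by omega), if_neg (by omega), zero_mul]
    rw [hrest, zero_add, if_neg (by omega), if_neg (by omega), if_pos (by omega),
      if_neg (by omega), if_pos (by omega), if_pos (by omega),
      show 2 * (k + 1) - 1 = 2 * k + 1 by omega, show 2 * (k + 1) - 2 = 2 * k by omega,
      show 2 * k + 1 + 1 = 2 * (k + 1) by ring]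
    ring

/-- **Core of THEOREM 3₀** (copy 1 strictly sub-neutral, copy 3 peeled): the kernel
`K(n,l) = (p + g₃ n) W′(n,l) + b₃ n W′(n-1,l) + h₃ n C′(n-1,l)` — `p·W₃^{(p)}` by the peeling identity,
`W′` the two-copy band matrix at level `q = p+1` and `C′ = [S,W′]` its commutator matrix — is totally
nonnegative. -/
theorem peeled_tn (b₁ b₂ b₃ g₁ g₂ g₃ p : ℝ) (hb₁ : 0 < b₁) (hb₂ : 0 < b₂) (hb₃ : 0 < b₃)
    (hg₁ : 0 < g₁) (hg₁' : g₁ < 1) (hg₂ : 0 < g₂) (hg₂' : g₂ ≤ 1) (hg₃ : 0 ≤ g₃) (hg₃' : g₃ ≤ 1)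
    (hp : 0 < p) (κ₀ κ₁ κ₂ : ℕ → ℝ)
    (hκ₀ : ∀ k : ℕ, κ₀ k = 1 + (g₁ + g₂) * k / (p + 1) + g₁ * g₂ * ((k : ℝ) * (k - 1)) / ((p + 1) * (p + 1 + 1)))
    (hκ₁ : ∀ k : ℕ, κ₁ k = ((b₁ + b₂) * k + (b₁ * g₂ + b₂ * g₁) * ((k : ℝ) * (k - 1)) / (p + 1 + 1)) / (p + 1))
    (hκ₂ : ∀ k : ℕ, κ₂ k = b₁ * b₂ * ((k : ℝ) * (k - 1)) / ((p + 1) * (p + 1 + 1)))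
    (W' C' : ℕ → ℕ → ℝ)
    (hW' : ∀ n l, W' n l = if l = n then κ₀ n else if l + 1 = n then κ₁ n else if l + 2 = n then κ₂ n else 0)
    (hC' : ∀ n l, C' n l = if l = n + 1 then κ₀ (n + 1) - κ₀ n else if l = n then κ₁ (n + 1) - κ₁ n
      else if l + 1 = n then κ₂ (n + 1) - κ₂ n else 0)
    {m : ℕ} (r c : Fin m → ℕ) (hr : StrictMono r) (hc : StrictMono c) :
    0 ≤ (Matrix.of fun i j => (p + g₃ * r i) * W' (r i) (c j) + b₃ * r i * W' (r i - 1) (c j)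
        + (1 - g₃) * r i * C' (r i - 1) (c j)).det := by
  -- the doubled kernel R̃: even t ↦ W′(t/2, ·), odd t ↦ C′(t/2, ·)
  let R : ℕ → ℕ → ℝ := fun t l =>
    if t % 2 = 0 then
      (if l = t / 2 then κ₀ (t / 2) else if l + 1 = t / 2 then κ₁ (t / 2)
        else if l + 2 = t / 2 then κ₂ (t / 2) else 0)
    else
      (if l = t / 2 + 1 then κ₀ (t / 2 + 1) - κ₀ (t / 2)
        else if l = t / 2 then κ₁ (t / 2 + 1) - κ₁ (t / 2)
        else if l + 1 = t / 2 then κ₂ (t / 2 + 1) - κ₂ (t / 2) else 0)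
  have hRtn : ∀ (k : ℕ) (r' c' : Fin k → ℕ), StrictMono r' → StrictMono c' →
      0 ≤ (Matrix.of fun i j => R (r' i) (c' j)).det := fun k r' c' hr' hc' =>
    HurwitzPair.hurwitzPair_tn b₁ b₂ g₁ g₂ (p + 1) hb₁ hb₂ hg₁ hg₁' hg₂ hg₂' (by linarith) κ₀ κ₁ κ₂
      hκ₀ hκ₁ hκ₂ r' c' hr' hc'
  -- rows of R in terms of W′ and C′
  have hReven : ∀ n l, R (2 * n) l = W' n l := by
    intro n l
    have h1 : (2 * n) % 2 = 0 := by omega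
    have h2 : (2 * n) / 2 = n := by omega
    show (if (2 * n) % 2 = 0 then _ else _) = _
    rw [if_pos h1, h2, hW']
  have hRodd : ∀ n l, R (2 * n + 1) l = C' n l := by
    intro n l
    have h1 : ¬ ((2 * n + 1) % 2 = 0) := by omega
    have h2 : (2 * n + 1) / 2 = n := by omega
    show (if (2 * n + 1) % 2 = 0 then _ else _) = _
    rw [if_neg h1, h2, hC']
  have hR0 : ∀ l, R 0 l = W' 0 l := fun l => hReven 0 l
  -- the left factor L(n,t) = [t=2n](p+g₃n) + [t+1=2n](h₃n) + [t+2=2n](b₃n)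
  let L : ℕ → ℕ → ℝ := fun n t =>
    if t = 2 * n then p + g₃ * n else if t + 1 = 2 * n then (1 - g₃) * n
      else if t + 2 = 2 * n then b₃ * n else 0
  have hLtn : ∀ (k : ℕ) (r' c' : Fin k → ℕ), StrictMono r' → StrictMono c' →
      0 ≤ (Matrix.of fun i j => L (r' i) (c' j)).det := by
    intro k r' c' hr' hc'
    refine StairTN.stairs_minor_nonneg L (fun n => 2 * n - 2) (fun n => 2 * n) (fun n => by omega)
      (fun n => by omega) ?_ ?_ ?_ r' c' hr' hc'
    · intro n t
      show 0 ≤ (if t = 2 * n then p + g₃ * n else if t + 1 = 2 * n then (1 - g₃) * n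
        else if t + 2 = 2 * n then b₃ * n else 0)
      split_ifs
      · positivity
      · exact mul_nonneg (by linarith) (by positivity)
      · positivity
      · exact le_rfl
    · intro n t ht
      show (if t = 2 * n then p + g₃ * n else if t + 1 = 2 * n then (1 - g₃) * n
        else if t + 2 = 2 * n then b₃ * n else 0) = 0
      rw [if_neg (by omega), if_neg (by omega), if_neg (by omega)]
    · intro n t ht
      show (if t = 2 * n then p + g₃ * n else if t + 1 = 2 * n then (1 - g₃) * n
        else if t + 2 = 2 * n then b₃ * n else 0) = 0
      rw [if_neg (by omega), if_neg (by omega), if_neg (by omega)]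
  -- the peeling identity: K(n,l) = Σ_{t ≤ 2n} L(n,t) R(t,l)
  have heq : (Matrix.of fun i j => (p + g₃ * r i) * W' (r i) (c j) + b₃ * r i * W' (r i - 1) (c j)
        + (1 - g₃) * r i * C' (r i - 1) (c j)) =
      Matrix.of fun i j => ∑ t ∈ range (2 * r i + 1), L (r i) t * R t (c j) := by
    ext i j
    simp only [Matrix.of_apply]
    rw [sum_doubled (fun n => p + g₃ * n) (fun n => (1 - g₃) * n) (fun n => b₃ * n) (fun t => R t (c j))
      (by simp) (by simp) (r i)]
    rcases Nat.eq_zero_or_pos (r i) with h0 | hpos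
    · rw [h0]
      simp only [Nat.cast_zero, mul_zero, zero_mul, add_zero, hR0]
    · obtain ⟨n, hn⟩ : ∃ n, r i = n + 1 := ⟨r i - 1, by omega⟩
      rw [hn, hReven, show 2 * (n + 1) - 1 = 2 * n + 1 by omega, hRodd,
        show 2 * (n + 1) - 2 = 2 * n by omega, hReven, show n + 1 - 1 = n by omega]
      ring
  rw [heq]
  exact StairTN.mulBand_minor_nonneg L R hLtn hRtn
    (fun n t ht => by
      show (if t = 2 * n then p + g₃ * n else if t + 1 = 2 * n then (1 - g₃) * n
        else if t + 2 = 2 * n then b₃ * n else 0) = 0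
      rw [if_neg (by omega), if_neg (by omega), if_neg (by omega)]) r c hr hc

/-- **THEOREM 3₀, main case** (copy 1 strictly sub-neutral: `g₁ < 1`). -/
theorem integerTriple_tn_of_lt (b₁ b₂ b₃ g₁ g₂ g₃ m : ℝ) (hb₁ : 0 < b₁) (hb₂ : 0 < b₂) (hb₃ : 0 < b₃)
    (hg₁ : 0 < g₁) (hg₁' : g₁ < 1) (hg₂ : 0 < g₂) (hg₂' : g₂ ≤ 1) (hg₃ : 0 < g₃) (hg₃' : g₃ ≤ 1)
    (hm : 2 < m) {k : ℕ} (r c : Fin k → ℕ) (hr : StrictMono r) (hc : StrictMono c) :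
    0 ≤ (Matrix.of fun i j =>
      (if r i = c j then
        m * (m - 1) * (m - 2) + (g₁ + g₂ + g₃) * (c j : ℝ) * (m * (m - 1))
          + (g₁ * g₂ + g₁ * g₃ + g₂ * g₃) * ((c j : ℝ) * ((c j : ℝ) - 1)) * m
          + g₁ * g₂ * g₃ * ((c j : ℝ) * ((c j : ℝ) - 1) * ((c j : ℝ) - 2))
       else if r i = c j + 1 then
        b₁ * (m * (m - 1) + (g₂ + g₃) * (c j : ℝ) * m + g₂ * g₃ * ((c j : ℝ) * ((c j : ℝ) - 1)))
          + b₂ * (m * (m - 1) + (g₁ + g₃) * (c j : ℝ) * m + g₁ * g₃ * ((c j : ℝ) * ((c j : ℝ) - 1)))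
          + b₃ * (m * (m - 1) + (g₁ + g₂) * (c j : ℝ) * m + g₁ * g₂ * ((c j : ℝ) * ((c j : ℝ) - 1)))
       else if r i = c j + 2 then
        b₁ * b₂ * (m + g₃ * (c j : ℝ)) + b₁ * b₃ * (m + g₂ * (c j : ℝ)) + b₂ * b₃ * (m + g₁ * (c j : ℝ))
       else if r i = c j + 3 then b₁ * b₂ * b₃ else 0)).det := by
  have hm1 : (0 : ℝ) < m - 1 := by linarith
  have hm2 : (0 : ℝ) < m - 2 := by linarith
  have hm0 : (0 : ℝ) < m := by linarith
  -- the two-copy data at level q = m - 1 (p = m - 2)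
  let κ₀ : ℕ → ℝ := fun k => 1 + (g₁ + g₂) * k / (m - 2 + 1) + g₁ * g₂ * ((k : ℝ) * (k - 1)) / ((m - 2 + 1) * (m - 2 + 1 + 1))
  let κ₁ : ℕ → ℝ := fun k => ((b₁ + b₂) * k + (b₁ * g₂ + b₂ * g₁) * ((k : ℝ) * (k - 1)) / (m - 2 + 1 + 1)) / (m - 2 + 1)
  let κ₂ : ℕ → ℝ := fun k => b₁ * b₂ * ((k : ℝ) * (k - 1)) / ((m - 2 + 1) * (m - 2 + 1 + 1))
  let W' : ℕ → ℕ → ℝ := fun n l => if l = n then κ₀ n else if l + 1 = n then κ₁ n else if l + 2 = n then κ₂ n else 0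
  let C' : ℕ → ℕ → ℝ := fun n l => if l = n + 1 then κ₀ (n + 1) - κ₀ n else if l = n then κ₁ (n + 1) - κ₁ n
      else if l + 1 = n then κ₂ (n + 1) - κ₂ n else 0
  let K : ℕ → ℕ → ℝ := fun n l => ((m - 2) + g₃ * n) * W' n l + b₃ * n * W' (n - 1) l + (1 - g₃) * n * C' (n - 1) l
  have hK : ∀ (k' : ℕ) (r' c' : Fin k' → ℕ), StrictMono r' → StrictMono c' →
      0 ≤ (Matrix.of fun i j => K (r' i) (c' j)).det := fun k' r' c' hr' hc' =>
    peeled_tn b₁ b₂ b₃ g₁ g₂ g₃ (m - 2) hb₁ hb₂ hb₃ hg₁ hg₁' hg₂ hg₂' hg₃.le hg₃' hm2 κ₀ κ₁ κ₂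
      (fun _ => rfl) (fun _ => rfl) (fun _ => rfl) W' C' (fun _ _ => rfl) (fun _ _ => rfl) r' c' hr' hc'
  -- the column-banded kernel 𝒪₀
  let O : ℕ → ℕ → ℝ := fun n l =>
      if n = l then
        m * (m - 1) * (m - 2) + (g₁ + g₂ + g₃) * (l : ℝ) * (m * (m - 1))
          + (g₁ * g₂ + g₁ * g₃ + g₂ * g₃) * ((l : ℝ) * ((l : ℝ) - 1)) * m
          + g₁ * g₂ * g₃ * ((l : ℝ) * ((l : ℝ) - 1) * ((l : ℝ) - 2))
       else if n = l + 1 then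
        b₁ * (m * (m - 1) + (g₂ + g₃) * (l : ℝ) * m + g₂ * g₃ * ((l : ℝ) * ((l : ℝ) - 1)))
          + b₂ * (m * (m - 1) + (g₁ + g₃) * (l : ℝ) * m + g₁ * g₃ * ((l : ℝ) * ((l : ℝ) - 1)))
          + b₃ * (m * (m - 1) + (g₁ + g₂) * (l : ℝ) * m + g₁ * g₂ * ((l : ℝ) * ((l : ℝ) - 1)))
       else if n = l + 2 then
        b₁ * b₂ * (m + g₃ * (l : ℝ)) + b₁ * b₃ * (m + g₂ * (l : ℝ)) + b₂ * b₃ * (m + g₁ * (l : ℝ))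
       else if n = l + 3 then b₁ * b₂ * b₃ else 0
  -- evaluation of W', C' on and off the bands
  have hW'v : ∀ n l, W' n l = if l = n then κ₀ n else if l + 1 = n then κ₁ n else if l + 2 = n then κ₂ n else 0 :=
    fun _ _ => rfl
  have hC'v : ∀ n l, C' n l = if l = n + 1 then κ₀ (n + 1) - κ₀ n else if l = n then κ₁ (n + 1) - κ₁ n
      else if l + 1 = n then κ₂ (n + 1) - κ₂ n else 0 := fun _ _ => rfl
  have hκ₀v : ∀ k : ℕ, κ₀ k = 1 + (g₁ + g₂) * k / (m - 2 + 1) + g₁ * g₂ * ((k : ℝ) * (k - 1)) / ((m - 2 + 1) * (m - 2 + 1 + 1)) :=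
    fun _ => rfl
  have hκ₁v : ∀ k : ℕ, κ₁ k = ((b₁ + b₂) * k + (b₁ * g₂ + b₂ * g₁) * ((k : ℝ) * (k - 1)) / (m - 2 + 1 + 1)) / (m - 2 + 1) :=
    fun _ => rfl
  have hκ₂v : ∀ k : ℕ, κ₂ k = b₁ * b₂ * ((k : ℝ) * (k - 1)) / ((m - 2 + 1) * (m - 2 + 1 + 1)) := fun _ => rfl
  have hKv : ∀ n l, K n l = ((m - 2) + g₃ * n) * W' n l + b₃ * n * W' (n - 1) l + (1 - g₃) * n * C' (n - 1) l :=
    fun _ _ => rfl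
  have hq1 : (m - 2 + 1 : ℝ) ≠ 0 := by intro h; linarith
  have hq2 : (m - 2 + 1 + 1 : ℝ) ≠ 0 := by intro h; linarith
  -- the scaling identity  O(n,l) · n! = m(m-1) · K(n,l) · l!
  have hscale : ∀ n l : ℕ, O n l * (n.factorial : ℝ) = m * (m - 1) * K n l * (l.factorial : ℝ) := by
    intro n l
    by_cases hnl : l ≤ n
    · obtain ⟨d, rfl⟩ := Nat.exists_eq_add_of_le hnl
      rcases d with _ | _ | _ | _ | d
      · -- d = 0
        have hO0 : O (l + 0) l = m * (m - 1) * (m - 2) + (g₁ + g₂ + g₃) * (l : ℝ) * (m * (m - 1))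
            + (g₁ * g₂ + g₁ * g₃ + g₂ * g₃) * ((l : ℝ) * ((l : ℝ) - 1)) * m
            + g₁ * g₂ * g₃ * ((l : ℝ) * ((l : ℝ) - 1) * ((l : ℝ) - 2)) := if_pos (by omega)
        rw [hO0, Nat.add_zero, hKv, hW'v, if_pos rfl]
        rcases Nat.eq_zero_or_pos l with rfl | hl
        · simp only [Nat.cast_zero, mul_zero, zero_mul, add_zero, Nat.factorial_zero, Nat.cast_one, mul_one]
          rw [hκ₀v]; push_cast; field_simp; ring
        · obtain ⟨l', rfl⟩ : ∃ l', l = l' + 1 := ⟨l - 1, by omega⟩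
          rw [show l' + 1 - 1 = l' by omega, hW'v l' (l' + 1), if_neg (by omega), if_neg (by omega), if_neg (by omega),
            hC'v, if_pos rfl, hκ₀v, hκ₀v]
          push_cast; field_simp; ring
      · -- d = 1
        have hO1 : O (l + (0 + 1)) l =
            b₁ * (m * (m - 1) + (g₂ + g₃) * (l : ℝ) * m + g₂ * g₃ * ((l : ℝ) * ((l : ℝ) - 1)))
            + b₂ * (m * (m - 1) + (g₁ + g₃) * (l : ℝ) * m + g₁ * g₃ * ((l : ℝ) * ((l : ℝ) - 1)))
            + b₃ * (m * (m - 1) + (g₁ + g₂) * (l : ℝ) * m + g₁ * g₂ * ((l : ℝ) * ((l : ℝ) - 1))) := by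
          show (if l + (0 + 1) = l then _ else _) = _; rw [if_neg (by omega), if_pos (by omega)]
        rw [hO1, show l + (0 + 1) = l + 1 by rfl, hKv, show l + 1 - 1 = l by omega, hW'v, if_neg (by omega), if_pos rfl,
          hW'v, if_pos rfl, hC'v, if_neg (by omega), if_pos rfl, Nat.factorial_succ, hκ₁v, hκ₁v, hκ₀v]
        push_cast; field_simp; ring
      · -- d = 2
        have hO2 : O (l + (0 + 1 + 1)) l =
            b₁ * b₂ * (m + g₃ * (l : ℝ)) + b₁ * b₃ * (m + g₂ * (l : ℝ)) + b₂ * b₃ * (m + g₁ * (l : ℝ)) := by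
          show (if l + (0 + 1 + 1) = l then _ else _) = _
          rw [if_neg (by omega), if_neg (by omega), if_pos (by omega)]
        rw [hO2, show l + (0 + 1 + 1) = l + 2 by rfl, hKv, show l + 2 - 1 = l + 1 by omega, hW'v,
          if_neg (by omega), if_neg (by omega), if_pos rfl, hW'v, if_neg (by omega), if_pos rfl,
          hC'v, if_neg (by omega), if_neg (by omega), if_pos rfl,
          show (l + 2).factorial = (l + 2) * ((l + 1) * l.factorial) by
            rw [Nat.factorial_succ, Nat.factorial_succ],
          hκ₂v, hκ₂v, hκ₁v]
        push_cast; field_simp; ring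
      · -- d = 3
        have hO3 : O (l + (0 + 1 + 1 + 1)) l = b₁ * b₂ * b₃ := by
          show (if l + (0 + 1 + 1 + 1) = l then _ else _) = _
          rw [if_neg (by omega), if_neg (by omega), if_neg (by omega), if_pos (by omega)]
        rw [hO3, show l + (0 + 1 + 1 + 1) = l + 3 by rfl, hKv, show l + 3 - 1 = l + 2 by omega, hW'v,
          if_neg (by omega), if_neg (by omega), if_neg (by omega), hW'v, if_neg (by omega), if_neg (by omega), if_pos rfl,
          hC'v, if_neg (by omega), if_neg (by omega), if_neg (by omega),
          show (l + 3).factorial = (l + 3) * ((l + 2) * ((l + 1) * l.factorial)) by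
            rw [Nat.factorial_succ, Nat.factorial_succ, Nat.factorial_succ],
          hκ₂v]
        push_cast; field_simp; ring
      · -- d ≥ 4: both sides vanish
        have hO4 : O (l + (d + 1 + 1 + 1 + 1)) l = 0 := by
          show (if l + (d + 1 + 1 + 1 + 1) = l then _ else _) = _
          rw [if_neg (by omega), if_neg (by omega), if_neg (by omega), if_neg (by omega)]
        rw [hO4, hKv, hW'v, if_neg (by omega), if_neg (by omega), if_neg (by omega), hW'v,
          if_neg (by omega), if_neg (by omega), if_neg (by omega), hC'v, if_neg (by omega), if_neg (by omega),
          if_neg (by omega)]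
        ring
    · -- n < l: both sides vanish
      have hOlt : O n l = 0 := by
        show (if n = l then _ else _) = _
        rw [if_neg (by omega), if_neg (by omega), if_neg (by omega), if_neg (by omega)]
      rw [hOlt, hKv, hW'v, if_neg (by omega), if_neg (by omega), if_neg (by omega)]
      rcases Nat.eq_zero_or_pos n with rfl | hn
      · simp
      · rw [hW'v, if_neg (by omega), if_neg (by omega), if_neg (by omega), hC'v, if_neg (by omega),
          if_neg (by omega), if_neg (by omega)]
        ring
  have hO : ∀ n l : ℕ, O n l = (m * (m - 1) / (n.factorial : ℝ)) * K n l * (l.factorial : ℝ) := by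
    intro n l
    have hnf : (n.factorial : ℝ) ≠ 0 := by positivity
    have h := hscale n l
    field_simp
    linarith [h]
  have hmat : (Matrix.of fun i j =>
      (if r i = c j then
        m * (m - 1) * (m - 2) + (g₁ + g₂ + g₃) * (c j : ℝ) * (m * (m - 1))
          + (g₁ * g₂ + g₁ * g₃ + g₂ * g₃) * ((c j : ℝ) * ((c j : ℝ) - 1)) * m
          + g₁ * g₂ * g₃ * ((c j : ℝ) * ((c j : ℝ) - 1) * ((c j : ℝ) - 2))
       else if r i = c j + 1 then
        b₁ * (m * (m - 1) + (g₂ + g₃) * (c j : ℝ) * m + g₂ * g₃ * ((c j : ℝ) * ((c j : ℝ) - 1)))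
          + b₂ * (m * (m - 1) + (g₁ + g₃) * (c j : ℝ) * m + g₁ * g₃ * ((c j : ℝ) * ((c j : ℝ) - 1)))
          + b₃ * (m * (m - 1) + (g₁ + g₂) * (c j : ℝ) * m + g₁ * g₂ * ((c j : ℝ) * ((c j : ℝ) - 1)))
       else if r i = c j + 2 then
        b₁ * b₂ * (m + g₃ * (c j : ℝ)) + b₁ * b₃ * (m + g₂ * (c j : ℝ)) + b₂ * b₃ * (m + g₁ * (c j : ℝ))
       else if r i = c j + 3 then b₁ * b₂ * b₃ else 0)) =
      Matrix.of fun i j => (m * (m - 1) / ((r i).factorial : ℝ)) * K (r i) (c j) * ((c j).factorial : ℝ) := by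
    ext i j
    exact hO (r i) (c j)
  rw [hmat, TNKernel.det_kernel_scale K (fun n => m * (m - 1) / (n.factorial : ℝ)) (fun l => (l.factorial : ℝ)) r c]
  refine mul_nonneg (Finset.prod_nonneg fun i _ => by positivity)
    (mul_nonneg (Finset.prod_nonneg fun j _ => by positivity) (hK k r c hr hc))

/-- **THEOREM 3₀ (three sub-neutral integer copies at `λ = 0`).**  For `b_j > 0`, `0 < g_j ≤ 1`, `m > 2`
the column-banded matrix `𝒪₀` with the four bands `d_0, …, d_3` above is totally nonnegative.
(The boundary case `g₁ = 1` follows from `g₁ < 1` by continuity of the minors in `g₁`.) -/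
theorem integerTriple_tn (b₁ b₂ b₃ g₁ g₂ g₃ m : ℝ) (hb₁ : 0 < b₁) (hb₂ : 0 < b₂) (hb₃ : 0 < b₃)
    (hg₁ : 0 < g₁) (hg₁' : g₁ ≤ 1) (hg₂ : 0 < g₂) (hg₂' : g₂ ≤ 1) (hg₃ : 0 < g₃) (hg₃' : g₃ ≤ 1)
    (hm : 2 < m) {k : ℕ} (r c : Fin k → ℕ) (hr : StrictMono r) (hc : StrictMono c) :
    0 ≤ (Matrix.of fun i j =>
      (if r i = c j then
        m * (m - 1) * (m - 2) + (g₁ + g₂ + g₃) * (c j : ℝ) * (m * (m - 1))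
          + (g₁ * g₂ + g₁ * g₃ + g₂ * g₃) * ((c j : ℝ) * ((c j : ℝ) - 1)) * m
          + g₁ * g₂ * g₃ * ((c j : ℝ) * ((c j : ℝ) - 1) * ((c j : ℝ) - 2))
       else if r i = c j + 1 then
        b₁ * (m * (m - 1) + (g₂ + g₃) * (c j : ℝ) * m + g₂ * g₃ * ((c j : ℝ) * ((c j : ℝ) - 1)))
          + b₂ * (m * (m - 1) + (g₁ + g₃) * (c j : ℝ) * m + g₁ * g₃ * ((c j : ℝ) * ((c j : ℝ) - 1)))
          + b₃ * (m * (m - 1) + (g₁ + g₂) * (c j : ℝ) * m + g₁ * g₂ * ((c j : ℝ) * ((c j : ℝ) - 1)))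
       else if r i = c j + 2 then
        b₁ * b₂ * (m + g₃ * (c j : ℝ)) + b₁ * b₃ * (m + g₂ * (c j : ℝ)) + b₂ * b₃ * (m + g₁ * (c j : ℝ))
       else if r i = c j + 3 then b₁ * b₂ * b₃ else 0)).det := by
  rcases lt_or_eq_of_le hg₁' with hlt | heq
  · exact integerTriple_tn_of_lt b₁ b₂ b₃ g₁ g₂ g₃ m hb₁ hb₂ hb₃ hg₁ hlt hg₂ hg₂' hg₃ hg₃' hm r c hr hc
  · -- g₁ = 1: continuity of the minor in g₁ from below
    let F : ℝ → ℝ := fun x => (Matrix.of fun i j =>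
      (if r i = c j then
        m * (m - 1) * (m - 2) + (x + g₂ + g₃) * (c j : ℝ) * (m * (m - 1))
          + (x * g₂ + x * g₃ + g₂ * g₃) * ((c j : ℝ) * ((c j : ℝ) - 1)) * m
          + x * g₂ * g₃ * ((c j : ℝ) * ((c j : ℝ) - 1) * ((c j : ℝ) - 2))
       else if r i = c j + 1 then
        b₁ * (m * (m - 1) + (g₂ + g₃) * (c j : ℝ) * m + g₂ * g₃ * ((c j : ℝ) * ((c j : ℝ) - 1)))
          + b₂ * (m * (m - 1) + (x + g₃) * (c j : ℝ) * m + x * g₃ * ((c j : ℝ) * ((c j : ℝ) - 1)))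
          + b₃ * (m * (m - 1) + (x + g₂) * (c j : ℝ) * m + x * g₂ * ((c j : ℝ) * ((c j : ℝ) - 1)))
       else if r i = c j + 2 then
        b₁ * b₂ * (m + g₃ * (c j : ℝ)) + b₁ * b₃ * (m + g₂ * (c j : ℝ)) + b₂ * b₃ * (m + x * (c j : ℝ))
       else if r i = c j + 3 then b₁ * b₂ * b₃ else 0)).det
    have hF : Continuous F := by
      refine Continuous.matrix_det (continuous_matrix fun i j => ?_)
      refine continuous_if_const _ (fun _ => by fun_prop) (fun _ => ?_)
      refine continuous_if_const _ (fun _ => by fun_prop) (fun _ => ?_)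
      refine continuous_if_const _ (fun _ => by fun_prop) (fun _ => ?_)
      exact continuous_if_const _ (fun _ => by fun_prop) (fun _ => by fun_prop)
    have hFpos : ∀ x, 0 < x → x < 1 → 0 ≤ F x := fun x hx hx1 =>
      integerTriple_tn_of_lt b₁ b₂ b₃ x g₂ g₃ m hb₁ hb₂ hb₃ hx hx1 hg₂ hg₂' hg₃ hg₃' hm r c hr hc
    have hlim : Filter.Tendsto F (nhdsWithin 1 (Set.Iio 1)) (nhds (F 1)) :=
      (hF.tendsto 1).mono_left nhdsWithin_le_nhds
    have hev : ∀ᶠ x in nhdsWithin 1 (Set.Iio 1), 0 ≤ F x := by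
      filter_upwards [Ioo_mem_nhdsLT (zero_lt_one' ℝ)] with x hx
      exact hFpos x hx.1 hx.2
    have h1 : 0 ≤ F 1 := ge_of_tendsto hlim hev
    rw [heq]
    exact h1

end IntegerTripleTN

end Summit.CriticalPhenomena.PercolationContinuityZ3.Theorems
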